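import Mathlib
import Summits.Ventures.PercRepro2.Defs
import Summits.Ventures.PercRepro2.Harris
import Summits.Ventures.PercRepro2.Graph
import Summits.Ventures.PercRepro2.Induced
import Summits.Ventures.PercRepro2.VdBKahn
import Summits.Ventures.PercRepro2.NestIID
import Summits.Ventures.PercRepro2.IIDRows

/-!
# Row (ΔMONO-NEST): the nested same-side surplus is decreasing under a common new avoided vertex
(blind cell PercRepro2, mine-1 g10; MINE-1.md §26)

`nestIID X Y` (NestIID.lean) is the two-copy nested-avoidance same-side sum; it is nonnegative for
`X ⊆ Y` (`nestIID_nonneg`, from van den Berg–Kahn). The row (ΔMONO-NEST) says that adding the same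
vertex `t` to both avoided sets does not increase it:
`nestIID (insert t X) (insert t Y) ≤ nestIID X Y` for `X ⊆ Y`, `t ∉ Y`.
Its diagonal `X = Y` is row (ΔMONO) (`DeltaMonoRow`, IIDRows.lean), since
`nestIID T T = 2 · bhkSlack T` (`nestIID_diag`). The difference is the "`t`-layer"
`Σ_{ω,ω'} w w' 1_{R_X}(ω) 1_{R_Y}(ω') 1[t ∈ C ∪ C'] σ_x σ_y` (`nestIID_sub_insert_eq_layer`),
so (ΔMONO-NEST) is the nested-avoidance statement with `t` forced into the union of the two
clusters. Census (mine-1 g10, asymk2.c, mild and extreme palettes): `n = 5` all graphs 0 / 20,160,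
`n = 6 m ≤ 8` 0 / 453,600 (nested pairs incl. `X = Y`); FALSE for incomparable `X, Y`
(4,154 / 64,800 at `n = 6 m ≤ 8`), exactly like `nestIID` itself.
-/

namespace Summit.Ventures.PercRepro2

section DeltaMonoNest

variable {V : Type*} {E : Type*} [Fintype E] [DecidableEq E] [Fintype V] [DecidableEq V]
  {R : Type*} [CommRing R] [LinearOrder R] [IsStrictOrderedRing R]

variable (p : E → R) (ends : E → Sym2 V) (s x y : V)

/-- **Row (ΔMONO-NEST)**: for nested avoided sets `X ⊆ Y` and `t ∉ Y`, adding `t` to both avoided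
sets does not increase the nested same-side surplus. -/
def DeltaMonoNestRow : Prop := ∀ (X Y : Finset V) (t : V), X ⊆ Y → t ∉ Y →
  nestIID p ends s x y (insert t X) (insert t Y) ≤ nestIID p ends s x y X Y

/-- (ΔMONO-NEST) ⟹ (ΔMONO): the diagonal `X = Y`. -/
theorem deltaMonoRow_of_deltaMonoNestRow (h : DeltaMonoNestRow p ends s x y) :
    DeltaMonoRow p ends s x y := by
  intro T t
  by_cases ht : t ∈ T
  · rw [Finset.insert_eq_of_mem ht]
  · have h1 := h T T t (Finset.Subset.refl T) ht
    rw [nestIID_diag p ends s x y, nestIID_diag p ends s x y] at h1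
    linarith

omit [DecidableEq E] [LinearOrder R] [IsStrictOrderedRing R] in
/-- The avoidance indicator of `insert t X` is the avoidance indicator of `X` times `1[s ↮ t]`. -/
lemma avoidInd_insert (X : Finset V) (t : V) (ω : Config E) :
    (avoidInd ends s (insert t X) ω : R) = avoidInd ends s X ω * (1 - connInd ends s t ω) := by
  classical
  simp only [avoidInd, connInd, avoidAll, Set.mem_setOf_eq, Finset.mem_insert, forall_eq_or_imp]
  by_cases hX : ∀ v ∈ X, ¬ Conn ends ω s v
  · by_cases ht : Conn ends ω s t
    · simp [ht]
    · simp [ht]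
  · by_cases ht : Conn ends ω s t
    · simp [hX, ht]
    · simp [hX, ht]

omit [LinearOrder R] [IsStrictOrderedRing R] in
/-- **The `t`-layer identity**: the drop of the nested surplus when `t` is added to both avoided
sets is the same-side sum restricted to `t ∈ C ∪ C'`. -/
theorem nestIID_sub_insert_eq_layer (X Y : Finset V) (t : V) :
    nestIID p ends s x y X Y - nestIID p ends s x y (insert t X) (insert t Y) =
      ∑ ω : Config E, ∑ ω' : Config E,
        weight p ω * weight p ω' * avoidInd ends s X ω * avoidInd ends s Y ω' *
          (1 - (1 - connInd ends s t ω) * (1 - connInd ends s t ω')) *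
          ((connInd ends s x ω - connInd ends s x ω') *
            (connInd ends s y ω - connInd ends s y ω')) := by
  unfold nestIID
  rw [← Finset.sum_sub_distrib]
  refine Finset.sum_congr rfl fun ω _ => ?_
  rw [← Finset.sum_sub_distrib]
  refine Finset.sum_congr rfl fun ω' _ => ?_
  rw [avoidInd_insert (R := R), avoidInd_insert (R := R)]
  ring

end DeltaMonoNest

end Summit.Ventures.PercRepro2
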